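import Literature.Topology.FourManifolds.AchiralLefschetzNullTower
import Literature.Topology.FourManifolds.AttachDataMorseGluing
import Literature.Topology.FourManifolds.CircleNbhdTrace
import Literature.Topology.FourManifolds.GluingUniqueness
import HarnessLib

/-!
# The null tower, fact 4: a circle surgery on the boundary of a compact 5-dimensional
# 2-handlebody bounds a compact 5-dimensional 2-handlebody (Milnor 1965, Thms. 3.12–3.13 with
# Lemma 3.7)

Topic `Literature/Topology/FourManifolds`; companion of `AchiralLefschetzNullTower.lean` (the five
printed inputs of the null tower of the line `hurwitz-deletion-presentation` of the crux
`ConvexBisection.AcyclicBisectionRigidity`, item stmt-SmoothPoincare4-10507).  This file DISCHARGES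
the fourth input, `Literature.Topology.FourManifolds.exists_isHandlebodyOfIndexLE_two_of_isCircleSurgery`,
at universe `0` (the instance used by the line), from tree bricks:

* the trace `ω(N, ν)` of the surgery along the tube `ν` of the circle is an elementary
  cobordism of index `2` from `N` to its top end `χ` (`CircleNbhd.trace`,
  `CircleNbhd.isElementary_trace`, Milnor 1965, Def. 3.10, Thm. 3.12; `CircleNbhdTrace.lean`,
  stated at universe `0`), and `χ` is the circle surgery of `N` along `ν`
  (`CircleNbhd.isOpenGluingWith_top`), hence diffeomorphic to `M`
  (`IsOpenGluing.nonempty_diffeomorph`, uniqueness of open gluings); re-ending the trace at `M`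
  (`Cobordism.compDiffeomorphRight`) keeps its Morse function (`Cobordism.IsMorseFunction.compDiffeomorphRight`);
* Milnor's Lemma 3.7 / Cor. 3.8 for the attachment `H ∪_N ω` (`AttachDataMorseGluing.lean`:
  `AttachData.exists_isHandlebodyOfIndexLE_of_isMorseFunction`, here in consumer shape
  `exists_cobordismAttachment_isHandlebodyOfIndexLE`): the adapted Morse function of `H` (indices
  `≤ 2`) and the Morse function of the trace (one critical point, of index `2`) glue to an adapted
  Morse function of `H' = H ∪_N ω` with indices `≤ 2`, and `∂H' = M`
  (`CobordismAttachment.range_jX_comp_inr`).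

Everything here is proved (theorems only).

## References

* J. Milnor, *Lectures on the h-cobordism theorem*, Princeton (1965), Lemma 3.7, Cor. 3.8,
  Def. 3.9–3.10, Thms. 3.12–3.13 (PDF pp. 15–21). [MilnorHCobordism1965]
* R. E. Gompf, A. I. Stipsicz, *4-manifolds and Kirby calculus*, GSM 20 (1999), §5.2.
  [GompfStipsiczGSM1999]
-/

open scoped Manifold ContDiff Topology
open Set Function Filter

noncomputable section

namespace Literature.Topology.FourManifolds

universe u

/-! ### The consumer shape of Milnor's Lemma 3.7 / Cor. 3.8 -/

section Consumer

variable {n : ℕ} {W : Type u} [TopologicalSpace W] [ChartedSpace (EuclideanHalfSpace (n + 1)) W]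
  {M N : Type u} [TopologicalSpace M] [ChartedSpace (EuclideanSpace ℝ (Fin n)) M]
  [TopologicalSpace N] [ChartedSpace (EuclideanSpace ℝ (Fin n)) N]
  [T2Space W] [CompactSpace W] [IsManifold (𝓡∂ (n + 1)) ∞ W] [Nonempty M] [IsManifold (𝓡 n) ∞ M]

/-- **Attaching a cobordism with a Morse function of index `≤ k` to a `k`-handlebody gives a
`k`-handlebody** — consumer shape of `AttachData.exists_isHandlebodyOfIndexLE_of_isMorseFunction`:
a compact Hausdorff second countable `(n+1)`-manifold with boundary `V` with an attachment
witness `CobordismAttachment b X ψ V` (so `∂V = N`) and `IsHandlebodyOfIndexLE n k V` (`n ≥ 1`).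
[cite: MilnorHCobordism1965, Lemma 3.7, Cor. 3.8, Thm. 3.12] -/
theorem exists_cobordismAttachment_isHandlebodyOfIndexLE [NeZero n] [SecondCountableTopology W] {k : ℕ}
    (b : BoundaryData (𝓡∂ (n + 1)) W (𝓡 n)) (X : Cobordism n M N) (ψ : b.carrier ≃ₘ⟮𝓡 n, 𝓡 n⟯ M)
    (hW : IsHandlebodyOfIndexLE n k W) {g : X.W → ℝ} (hg : X.IsMorseFunction g)
    (hgk : ∀ z, IsMCriticalPt (𝓡∂ (n + 1)) g z → morseIndex (𝓡∂ (n + 1)) g z ≤ k) :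
    ∃ (V : Type u) (_ : TopologicalSpace V) (_ : T2Space V) (_ : SecondCountableTopology V)
      (_ : ChartedSpace (EuclideanHalfSpace (n + 1)) V) (_ : IsManifold (𝓡∂ (n + 1)) ∞ V)
      (_ : CompactSpace V) (_ : CobordismAttachment b X ψ V), IsHandlebodyOfIndexLE n k V := by
  obtain ⟨f, hf, hfk⟩ := hW
  obtain ⟨G, hG⟩ := AttachData.exists_isHandlebodyOfIndexLE_of_isMorseFunction b X ψ hf hfk hg hgk
  exact ⟨G.d.Glued, inferInstance, inferInstance, inferInstance, inferInstance, inferInstance,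
    inferInstance, G.attachment, hG⟩

end Consumer

/-! ### Re-ending a cobordism keeps its Morse functions -/

section ReEnd

variable {n : ℕ} {M N N' : Type u} [TopologicalSpace M] [ChartedSpace (EuclideanSpace ℝ (Fin n)) M]
  [TopologicalSpace N] [ChartedSpace (EuclideanSpace ℝ (Fin n)) N]
  [TopologicalSpace N'] [ChartedSpace (EuclideanSpace ℝ (Fin n)) N']
  [IsManifold (𝓡 n) ∞ N] [IsManifold (𝓡 n) ∞ N']

/-- A Morse function of the triad `(W; M, N)` is a Morse function of the re-ended triad
`(W; M, N')`, `inr' = inr ∘ φ` (same total space, same ends as sets). [cite: MilnorHCobordism1965, Def. 2.3] -/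
theorem Cobordism.IsMorseFunction.compDiffeomorphRight {c : Cobordism n M N} {f : c.W → ℝ}
    (hf : c.IsMorseFunction f) (φ : N' ≃ₘ⟮𝓡 n, 𝓡 n⟯ N) : (c.compDiffeomorphRight φ).IsMorseFunction f :=
  ⟨hf.1, hf.2.1, fun y => hf.2.2.1 (φ y), hf.2.2.2.1, hf.2.2.2.2⟩

/-- Re-ending an elementary cobordism gives an elementary cobordism of the same index.
[cite: MilnorHCobordism1965, Def. 3.10] -/
theorem Cobordism.IsElementary.compDiffeomorphRight {c : Cobordism n M N} {k : ℕ}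
    (h : c.IsElementary k) (φ : N' ≃ₘ⟮𝓡 n, 𝓡 n⟯ N) : (c.compDiffeomorphRight φ).IsElementary k := by
  obtain ⟨f, hf, hu, hk⟩ := h
  exact ⟨f, hf.compDiffeomorphRight φ, hu, hk⟩

end ReEnd

/-! ### Fact 4 of the null tower at universe `0` -/

/-- **Discharge of fact 4 of the null tower at universe `0`** (the module docstring displays the
argument): if `N = ∂H` for a compact 5-dimensional 2-handlebody `H` and `M` is a circle surgery
of `N`, then `M = ∂H'` for the compact 5-dimensional 2-handlebody `H' = H ∪_N ω(N, ν)`, the trace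
of the surgery attached to `H` (Milnor 1965, Thm. 3.12: the trace is elementary of index `2`;
Lemma 3.7 / Cor. 3.8: the Morse functions glue with indices `≤ 2`; Thm. 3.13 / uniqueness of open
gluings: the top end of the trace is `M`). [cite: MilnorHCobordism1965, Lemma 3.7, Thms. 3.12–3.13] -/
theorem exists_isHandlebodyOfIndexLE_two_of_isCircleSurgery_holds0 :
    exists_isHandlebodyOfIndexLE_two_of_isCircleSurgery.{0} := by
  intro N M _ _ _ _ _ _ _ _ _ _ _ H _ _ _ _ _ _ hH φ hφ hφr c hs
  obtain ⟨ν, hglue⟩ := hs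
  obtain ⟨e⟩ := IsOpenGluing.nonempty_diffeomorph ν.isOpenGluingWith_top.isOpenGluing hglue
  -- the trace of the surgery, re-ended at `M`
  set X : Cobordism (3 + 1) N M := ν.trace.compDiffeomorphRight e.symm with hX
  obtain ⟨g, hg, -, hg2⟩ := ν.isElementary_trace
  have hgX : X.IsMorseFunction g := hg.compDiffeomorphRight e.symm
  have hgk : ∀ z, IsMCriticalPt (𝓡∂ (3 + 1 + 1)) g z → morseIndex (𝓡∂ (3 + 1 + 1)) g z ≤ 2 :=
    fun z hz => (hg2 z hz).le
  -- the boundary datum of `H` carried by `N`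
  let b : BoundaryData (𝓡∂ (3 + 1 + 1)) H (𝓡 (3 + 1)) :=
    { carrier := N, incl := φ, isSmoothEmbedding := hφ, range_incl := hφr }
  haveI : Nonempty N := ⟨c ⟨EuclideanSpace.single 0 1, by simp⟩⟩
  have hH' : IsHandlebodyOfIndexLE (3 + 1) 2 H := hH
  obtain ⟨V, _, _, _, _, _, _, A, hV⟩ :=
    exists_cobordismAttachment_isHandlebodyOfIndexLE (k := 2) b X (Diffeomorph.refl (𝓡 (3 + 1)) N ∞) hH' hgX hgk
  exact ⟨V, inferInstance, inferInstance, inferInstance, inferInstance, inferInstance, inferInstance, hV,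
    A.jX ∘ X.inr, A.isSmoothEmbedding_jX_comp_inr, A.range_jX_comp_inr⟩

end Literature.Topology.FourManifolds
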